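import Summits.BirchSwinnertonDyer.BirchSwinnertonDyer.Theorems.SylvesterTwoHeegnerIndexCMHalfBlockTwo
import Summits.BirchSwinnertonDyer.BirchSwinnertonDyer.Theorems.SylvesterTwoHeegnerIndexCMHalfBlockOne
import Summits.BirchSwinnertonDyer.BirchSwinnertonDyer.Theorems.SylvesterTwoHeegnerIndexCMHalfBottom
import Summits.BirchSwinnertonDyer.BirchSwinnertonDyer.Theorems.SylvesterTwoHeegnerIndexCMHalfPairLocalThree
import Summits.BirchSwinnertonDyer.BirchSwinnertonDyer.Theorems.SylvesterTwoHeegnerIndexCMHalfLayerL1Choices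
import Summits.BirchSwinnertonDyer.BirchSwinnertonDyer.Theorems.SylvesterTwoHeegnerIndexCMFlipLayerL1
import HarnessLib

/-!
# (S9) of leaf (L1) at `p ≡ 7 (mod 9)`, crux `UpperOffV0HSYPlus` (stmt-BirchSwinnertonDyer-19804): THE HALVED ASSEMBLY —
# `stub_layerL1Seven` of VARIANT M MODULO {`Dt` of degree 6, #19, #20} AND the displayed TOWER FIXING (cell lemma W2)

Skeleton VARIANT M 406ca288e244d392; planner D507 (4), D510.  ONE theorem whose TYPE is `stub_layerL1Seven`'s VERBATIM
(`(★) → PublishedFactsTwoPlus → …`) behind four displayed hypotheses: `Dt`/`hdeg`, the named display `hD` (#19), (ES2) `hES2`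
(#20) — as at `p ≡ 4 (9)` (#H-d2) — and **`hTF`, THE TOWER FIXING** (memo two §67.2 LEMMA W2: at the bottom an involution
`s ∈ Gal(K[9p]/K)` fixing `∛3, ∛p` and HSY's `y₁`; at every Kolyvagin level `n` an automorphism `φ_n ∈ Aut_K K[9pn]`
restricting to `s` and fixing `y_n` (W2-b), with, at each `w ∣ 3`, an open odd-index `Φ ≤ Γ_{K_w}` acting on the embedded
`K[9pn]` through `{1, φ_n}` (W2-a/d)) — a CELL lemma (Shimura reciprocity on `X₀(243)` + `ThmCShimuraCertificate`), NOT
print, NOT in the tree, desk (M-K3-7) pending; kept INLINE (planner D510 (a)).  Proof = #H-d2's architecture on the HALF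
index set `(𝒢₀⧸H) × H′`: #S1 (half point `Y′`, `2Y′ = Y₁`, exponent-0 display) → #23 `layerL1Seven_of_point`; #S9b
(choices) → #S6 (half block 1) → #S8 (half block 2) → #S9a (`w ∣ 3`) → #24 `L1_of_cmFrameClasses_seven`.
HONEST LABEL: a CONDITIONAL closure; the ledger stub is NOT closed; nothing asserted on 19804; X12.CMAtTwo NOT proved;
BSD is not proved by any of this, for any curve.  `set_option maxHeartbeats 3200000 in` scoped to the one theorem.
`--supports stmt-BirchSwinnertonDyer-19804 --as helper`.
-/

set_option linter.dupNamespace false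
set_option autoImplicit false

noncomputable section

open scoped Classical Pointwise

namespace Summit.BirchSwinnertonDyer.BirchSwinnertonDyer.Theorems.SylvesterTwoCMHalf

open WeierstrassCurve Field NumberField IsDedekindDomain Finset
open Literature.NumberTheory.EllipticCurves Literature.NumberTheory.GaloisRepresentations
  Literature.NumberTheory.EllipticCurves.ModularForms
  Literature.NumberTheory.EllipticCurves.HuShuYin2019
  Literature.NumberTheory.EllipticCurves.KolyvaginCocycle
  Literature.NumberTheory.EllipticCurves.RingClassField
  Summit.BirchSwinnertonDyer.BirchSwinnertonDyer.Theses.SylvesterTwoHeegnerIndex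
  Summit.BirchSwinnertonDyer.BirchSwinnertonDyer.Theorems
  Summit.BirchSwinnertonDyer.BirchSwinnertonDyer.Theorems.SylvesterTwoCoupledDescentCebotarev
  Summit.BirchSwinnertonDyer.BirchSwinnertonDyer.Theorems.SylvesterTwoCMData
  Summit.BirchSwinnertonDyer.BirchSwinnertonDyer.Theorems.SylvesterTwoCMFlip
  Summit.BirchSwinnertonDyer.Rank1Residual.X11b Summit.BirchSwinnertonDyer.Rank1Residual.X11b.RingClassTower

variable {K : Type} [Field K] [NumberField K]

set_option maxHeartbeats 3200000 in
/-- **(S9) THE HALVED ASSEMBLY — `stub_layerL1Seven` of VARIANT M, MODULO {`Dt` of degree 6, #19, #20} AND THE DISPLAYED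
TOWER FIXING `hTF`** (cell lemma W2, memo two §67.2; unrefereed): the stub's statement VERBATIM.  CONDITIONAL closure; the
stub stays open on the ledger; BSD is not proved by any of this.
[cite: HuShuYin2019, Thm. 1.4, §2 Prop. 2.4 / Cor. 2.5, §3 p. 8, §4.1] [cite: GrossLMS1991, §3–§6] [cite: Nekovar2007, Prop. 4.9] -/
theorem layerL1Seven_of_named_of_flip_of_fixing
    (Dt : ModularParametrizationData (⟨0, 0, 1, 0, -1⟩ : WeierstrassCurve ℚ) 243) (hdeg : Dt.deg = 6)
    (hD : shaAnPair_mul_height_eq_two_zpow_mul_height_named)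
    (hES2 : Nekovar2007.cmPoint_frobeniusCongruence)
    (hTF : ∀ (p : ℕ), p.Prime → p % 9 = 7 → ∀ (K : Type) [Field K] [NumberField K] (ω : K), ω ^ 2 + ω + 1 = 0 →
      Module.finrank ℚ K = 2 → ∀ (ι : K →+* ℂ) (c₃ cp : ringClassField K ι (9 * p)), c₃ ^ 3 = 3 →
      cp ^ 3 = (p : ringClassField K ι (9 * p)) →
      ∀ (y₁ : ((⟨0, 0, 1, 0, -1⟩ : WeierstrassCurve ℚ).baseChange (ringClassField K ι (9 * p))).toAffine.Point),
        Affine.Point.map (W' := (⟨0, 0, 1, 0, -1⟩ : WeierstrassCurve ℚ)) (ringClassField K ι (9 * p)).subtype.toRatAlgHom y₁ =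
          Dt.φ (heegnerTau (81 * ((p : ℤ) ^ 2 + 4 * p + 16), -(9 * (4 * (p : ℤ) ^ 2 + 17 * p + 72)), 4 * (p : ℤ) ^ 2 + 18 * p + 81)) →
      ∃ s : ringClassField K ι (9 * p) ≃ₐ[K] ringClassField K ι (9 * p), s ≠ 1 ∧ s * s = 1 ∧ s c₃ = c₃ ∧ s cp = cp ∧
        pointGalHom (⟨0, 0, 1, 0, -1⟩ : WeierstrassCurve ℚ) (ringClassField K ι (9 * p)) (s.restrictScalars ℚ) y₁ = y₁ ∧
        ∀ (n : ℕ), n ≠ 0 → (∀ q ∈ n.primeFactors, q % 3 = 2) →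
          ∀ (hle : ringClassField K ι (9 * p) ≤ ringClassField K ι (9 * p * n))
            (e : ringClassField K ι (9 * p * n) →+* AlgebraicClosure K),
            (∀ k : K, e (algebraMap K (ringClassField K ι (9 * p * n)) k) = algebraMap K (AlgebraicClosure K) k) →
          ∀ (y : ((⟨0, 0, 1, 0, -1⟩ : WeierstrassCurve ℚ).baseChange (ringClassField K ι (9 * p * n))).toAffine.Point),
            Affine.Point.map (W' := (⟨0, 0, 1, 0, -1⟩ : WeierstrassCurve ℚ)) (ringClassField K ι (9 * p * n)).subtype.toRatAlgHom y =
              Dt.φ (heegnerTau ((n : ℤ) ^ 2 * (81 * ((p : ℤ) ^ 2 + 4 * p + 16)),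
                (n : ℤ) * (-(9 * (4 * (p : ℤ) ^ 2 + 17 * p + 72))), 4 * (p : ℤ) ^ 2 + 18 * p + 81)) →
          ∃ φ : ringClassField K ι (9 * p * n) ≃ₐ[K] ringClassField K ι (9 * p * n),
            (∀ x : ringClassField K ι (9 * p), φ (RingClassField.inclusion ι hle x) = RingClassField.inclusion ι hle (s x)) ∧
            pointGalHom (⟨0, 0, 1, 0, -1⟩ : WeierstrassCurve ℚ) (ringClassField K ι (9 * p * n)) (φ.restrictScalars ℚ) y = y ∧
            ∀ (v : HeightOneSpectrum (𝓞 K)), ((3 : ℕ) : 𝓞 K) ∈ v.asIdeal →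
              ∃ Φ : Subgroup (absoluteGaloisGroup (v.adicCompletion K)),
                IsOpen (Φ : Set (absoluteGaloisGroup (v.adicCompletion K))) ∧ IsCoprime (Φ.index : ℤ) ((2 : ℕ) : ℤ) ∧
                ∀ τ ∈ Φ, (∀ x : ringClassField K ι (9 * p * n), (show AlgebraicClosure K ≃ₐ[K] AlgebraicClosure K from
                    resGal (K := K) (v.adicCompletion K) τ) (e x) = e x) ∨
                  (∀ x : ringClassField K ι (9 * p * n), (show AlgebraicClosure K ≃ₐ[K] AlgebraicClosure K from
                    resGal (K := K) (v.adicCompletion K) τ) (e x) = e (φ x))) :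
    SylvesterTwoNonneg.HSYPointTwoDivisibleSevenModNine →
    (PublishedFactsTwoPlus →
      ∀ (p : ℕ), p.Prime → p % 9 = 7 → (¬ ∃ x : ZMod p, x ^ 3 = 3) →
        ∀ (A B : WeierstrassCurve ℚ) [A.IsElliptic] [A.IsGloballyMinimal] [B.IsElliptic]
          [B.IsGloballyMinimal], (∃ C : VariableChange ℚ, C • B = HuShuYin2019.cubeSumCurve (p : ℚ)) →
          (∃ C : VariableChange ℚ, C • A = HuShuYin2019.cubeSumCurve (3 * (p : ℚ) ^ 2)) →
          ∀ (qB qA : ℚ), shaAn B = (qB : ℂ) → shaAn A = (qA : ℂ) → qB * qA ≠ 0 →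
            padicValRat 2 (qB * qA) = 0 →
            ∀ (K : Type) [Field K] [NumberField K] (ω : K), ω ^ 2 + ω + 1 = 0 →
              Module.finrank ℚ K = 2 →
            ∀ Y₀ : ((cubeSumCurve (p : ℚ)).baseChange K).toAffine.Point,
              (¬ ∃ Q : ((cubeSumCurve (p : ℚ)).baseChange K).toAffine.Point, (2 : ℕ) • Q = Y₀) →
            ∃ (cA : ℕ → galH1Torsion ((cubeSumCurve (3 * (p : ℚ) ^ 2)).baseChange K) (2 : ℕ))
              (cB : ℕ → galH1Torsion ((cubeSumCurve (p : ℚ)).baseChange K) (2 : ℕ)),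
            (∀ ℓ, (ℓ.Prime ∧ ¬ ℓ ∣ (cubeSumCurve (3 * (p : ℚ) ^ 2)).conductorNorm ℤ ∧
                ¬ ℓ ∣ (cubeSumCurve (p : ℚ)).conductorNorm ℤ ∧ ¬ ((ℓ : ℤ) ∣ NumberField.discr K) ∧ ℓ ≠ 2 ∧
                (Ideal.span {(ℓ : 𝓞 K)}).IsPrime ∧
                FrobEqFrobInfty (cubeSumCurve (3 * (p : ℚ) ^ 2)) K 2 ℓ ∧
                FrobEqFrobInfty (cubeSumCurve (p : ℚ)) K 2 ℓ) →
              (∀ v : HeightOneSpectrum (𝓞 K), (ℓ : 𝓞 K) ∉ v.asIdeal →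
                cA ℓ ∈ selmerLocalKer ((cubeSumCurve (3 * (p : ℚ) ^ 2)).baseChange K)
                  (v.adicCompletion K) (2 : ℕ)) ∧
              (∀ x : InfinitePlace K, cA ℓ ∈ selmerLocalKer
                ((cubeSumCurve (3 * (p : ℚ) ^ 2)).baseChange K) x.Completion (2 : ℕ)) ∧
              (∀ v : HeightOneSpectrum (𝓞 K), (ℓ : 𝓞 K) ∈ v.asIdeal →
                (cA ℓ ∈ selmerLocalKer ((cubeSumCurve (3 * (p : ℚ) ^ 2)).baseChange K)
                    (v.adicCompletion K) (2 : ℕ) ↔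
                  kummerClassOfPoint (cubeSumCurve (p : ℚ)) K Nat.prime_two Y₀ ∈
                    ((cubeSumCurve (p : ℚ)).baseChange K).torsionLocalKer (v.adicCompletion K) (2 : ℕ)))) ∧
            (∀ ℓ ℓ', (ℓ.Prime ∧ ¬ ℓ ∣ (cubeSumCurve (3 * (p : ℚ) ^ 2)).conductorNorm ℤ ∧
                ¬ ℓ ∣ (cubeSumCurve (p : ℚ)).conductorNorm ℤ ∧ ¬ ((ℓ : ℤ) ∣ NumberField.discr K) ∧ ℓ ≠ 2 ∧
                (Ideal.span {(ℓ : 𝓞 K)}).IsPrime ∧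
                FrobEqFrobInfty (cubeSumCurve (3 * (p : ℚ) ^ 2)) K 2 ℓ ∧
                FrobEqFrobInfty (cubeSumCurve (p : ℚ)) K 2 ℓ) →
              (ℓ'.Prime ∧ ¬ ℓ' ∣ (cubeSumCurve (3 * (p : ℚ) ^ 2)).conductorNorm ℤ ∧
                ¬ ℓ' ∣ (cubeSumCurve (p : ℚ)).conductorNorm ℤ ∧ ¬ ((ℓ' : ℤ) ∣ NumberField.discr K) ∧
                ℓ' ≠ 2 ∧ (Ideal.span {(ℓ' : 𝓞 K)}).IsPrime ∧
                FrobEqFrobInfty (cubeSumCurve (3 * (p : ℚ) ^ 2)) K 2 ℓ' ∧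
                FrobEqFrobInfty (cubeSumCurve (p : ℚ)) K 2 ℓ') → ℓ ≠ ℓ' →
              (∀ v : HeightOneSpectrum (𝓞 K), (ℓ : 𝓞 K) ∉ v.asIdeal → (ℓ' : 𝓞 K) ∉ v.asIdeal →
                cB (ℓ * ℓ') ∈ selmerLocalKer ((cubeSumCurve (p : ℚ)).baseChange K)
                  (v.adicCompletion K) (2 : ℕ)) ∧
              (∀ x : InfinitePlace K,
                cB (ℓ * ℓ') ∈ selmerLocalKer ((cubeSumCurve (p : ℚ)).baseChange K) x.Completion (2 : ℕ)) ∧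
              (∀ v : HeightOneSpectrum (𝓞 K), (ℓ : 𝓞 K) ∈ v.asIdeal →
                (cB (ℓ * ℓ') ∈ selmerLocalKer ((cubeSumCurve (p : ℚ)).baseChange K)
                    (v.adicCompletion K) (2 : ℕ) ↔
                  cA ℓ' ∈ ((cubeSumCurve (3 * (p : ℚ) ^ 2)).baseChange K).torsionLocalKer
                    (v.adicCompletion K) (2 : ℕ))))) := by
  intro hC
  refine layerL1Seven_of_point (h := fun p hp hp7 h3 K _ _ ω hω h2 ↦ ?_)
  have hp3 : p % 3 = 1 := (by omega); have hp0 : p ≠ 0 := hp.ne_zero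
  have hp0' : (p : ℚ) ≠ 0 := by exact_mod_cast hp0
  have hK := JZero.isImaginaryQuadratic_of_sq_add_self_add_one hω h2
  have hm0 : 9 * p ≠ 0 := mul_ne_zero (by norm_num) hp0
  haveI := isElliptic_sylvesterNineMinimal; haveI := isGloballyMinimal_sylvesterNineMinimal
  haveI hBell : ((cubeSumCurve (p : ℚ)).baseChange K).IsElliptic := isElliptic_cubeSumCurve_baseChange K hp0'
  haveI : Algebra.IsAlgebraic ℚ K := Algebra.IsAlgebraic.of_finite ℚ K
  let ι : K →+* ℂ := (IsAlgClosed.lift : K →ₐ[ℚ] ℂ).toRingHom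
  obtain ⟨emb, hembK, hcoh⟩ := exists_coherent_emb (K := K) ι
  haveI := (finiteDimensional_and_isGalois_ringClassField hK ι hm0).1
  haveI := (finiteDimensional_and_isGalois_ringClassField hK ι hm0).2
  obtain ⟨κ, hκG, hκ⟩ := exists_frameTransport_pinned K
  obtain ⟨vB, vA, ψB, ψA, ρ, hvBc, hvB, -, hvAc, hvA0, hvB3, hvA3, hψB, hψA, hρ, hρρ, hlawB, hlawA, hρcomm⟩ :=
    exists_coupledFrame (K := K) hω hp0
  obtain ⟨r₃, hr₃⟩ := IsAlgClosed.exists_pow_nat_eq (3 : ℂ) (by norm_num : 0 < 3)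
  obtain ⟨rp, hrp⟩ := IsAlgClosed.exists_pow_nat_eq (p : ℂ) (by norm_num : 0 < 3)
  have hrp_mem : rp ∈ ringClassField K ι (9 * p) := by
    have h := cubeRoot_mem_ringClassField_nine_mul hω h2 ι hp0 one_ne_zero rp hrp
    rwa [mul_one] at h
  let c₃ : ringClassField K ι (9 * p) := ⟨r₃, cubeRoot_three_mem_ringClassField hω h2 ι hp0 r₃ hr₃⟩
  let cp : ringClassField K ι (9 * p) := ⟨rp, hrp_mem⟩
  have hc₃ : c₃ ^ 3 = 3 := by apply Subtype.ext; push_cast; exact hr₃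
  have hcp : cp ^ 3 = (p : ringClassField K ι (9 * p)) := by apply Subtype.ext; push_cast; exact hrp
  obtain ⟨N₀, hN₀, H, hH, T, hT, -, hfin, hbij⟩ := exists_bottom_transversal hK ι hp0 (emb (9 * p)) (hembK _) c₃ cp
  haveI := hfin
  haveI : Fintype ((ringClassField K ι (9 * p) ≃ₐ[K] ringClassField K ι (9 * p)) ⧸ H) := Fintype.ofFinite _; haveI : Fintype H := Fintype.ofFinite _
  let t : ((ringClassField K ι (9 * p) ≃ₐ[K] ringClassField K ι (9 * p)) ⧸ H) × H → absoluteGaloisGroup K :=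
    fun i ↦ T (Quotient.out i.1) * T (i.2 : _)
  have ht' : ∀ q h, t (q, h) = T (Quotient.out q) * T (h : _) := fun _ _ ↦ rfl
  have ht := hbij t ht'
  let ιe : (m : ℕ) → (letI : DecidableEq (ringClassField K ι m) := fun a b ↦ Classical.propDecidable (a = b)
      ((⟨0, 0, 1, 0, -1⟩ : WeierstrassCurve ℚ).baseChange (ringClassField K ι m)).toAffine.Point →+ geomPoints ((⟨0, 0, 1, 0, -1⟩ : WeierstrassCurve ℚ).baseChange K)) := fun m ↦
    letI : DecidableEq (ringClassField K ι m) := fun a b ↦ Classical.propDecidable (a = b)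
    Affine.Point.map (W' := (⟨0, 0, 1, 0, -1⟩ : WeierstrassCurve ℚ)) (emb m).toRatAlgHom
  have hιe : ∀ (m : ℕ) P, ιe m P = Affine.Point.map (W' := (⟨0, 0, 1, 0, -1⟩ : WeierstrassCurve ℚ)) (emb m).toRatAlgHom P := fun _ _ ↦ rfl
  have hNex : ∀ m : ℕ, ∃ N : Subgroup (absoluteGaloisGroup K), ∀ g : absoluteGaloisGroup K, g ∈ N ↔
      ∀ x : ringClassField K ι m, (show AlgebraicClosure K ≃ₐ[K] AlgebraicClosure K from g) (emb m x) = emb m x :=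
    fun m ↦ exists_subgroup_mem_iff (emb m) (hembK m)
  let N : ℕ → Subgroup (absoluteGaloisGroup K) := fun m ↦ Classical.choose (hNex m)
  have hN : ∀ m (g : absoluteGaloisGroup K), g ∈ N m ↔
      ∀ x : ringClassField K ι m, (show AlgebraicClosure K ≃ₐ[K] AlgebraicClosure K from g) (emb m x) = emb m x :=
    fun m ↦ Classical.choose_spec (hNex m)
  obtain ⟨y₁, hy₁⟩ := exists_map_eq_phi_sylvesterTau_one_of_sq_add_self_add_one hω h2 ι Dt hp3
  -- ### THE TOWER FIXING (displayed): the bottom involution `s`, a half `H′` of `H`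
  obtain ⟨s, hs1, hs2, hs3, hsp, hsy, hTFn⟩ := hTF p hp hp7 K ω hω h2 ι c₃ cp hc₃ hcp y₁ hy₁
  set sH : H := ⟨s, (hH s).mpr ⟨hs3, hsp⟩⟩ with hsHdef
  have hsH2 : sH * sH = 1 := Subtype.ext hs2
  have hsH1 : sH ≠ 1 := fun e ↦ hs1 (congrArg Subtype.val e)
  obtain ⟨H', hH'⟩ := exists_half sH hsH1 hsH2
  have hsy' : pointGalHom (⟨0, 0, 1, 0, -1⟩ : WeierstrassCurve ℚ) (ringClassField K ι (9 * p))
      ((sH : _ ≃ₐ[K] _).restrictScalars ℚ) y₁ = y₁ := hsy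
  -- ### the HALF point `Y′` (#S1): `2 • Y′ = Y₁`, exponent-0 display
  obtain ⟨T₃, hT₃, Y₁, Y', hY₁, -, h2Y', hdisp⟩ := exists_halfPoint_of_named_of_thmC hω h2 ι hD hC Dt hdeg hp hp7 h3 κ hκG
    hκ hvBc hvB hvB3 hψB hρ hlawB (emb (9 * p)) (hembK _) (ιe (9 * p)) (hιe _) N₀ hN₀ hc₃ hcp H hH sH H' hH' y₁ hy₁ hsy'
  refine ⟨Y', hdisp, fun _ ↦ ?_⟩
  have hdivA : ∀ P : geomPoints ((cubeSumCurve (3 * (p : ℚ) ^ 2)).baseChange K), ∃ R : geomPoints ((cubeSumCurve (3 * (p : ℚ) ^ 2)).baseChange K), ((2 : ℕ) : ℤ) • R = P :=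
    ((cubeSumCurve (3 * (p : ℚ) ^ 2)).baseChange K).zsmul_geomPoints_surjective_of_charZero (by norm_num)
  have hdivB : ∀ P : geomPoints ((cubeSumCurve (p : ℚ)).baseChange K), ∃ R : geomPoints ((cubeSumCurve (p : ℚ)).baseChange K), ((2 : ℕ) : ℤ) • R = P :=
    ((cubeSumCurve (p : ℚ)).baseChange K).zsmul_geomPoints_surjective_of_charZero (by norm_num)
  let Kol : ℕ → Prop := fun ℓ ↦ ℓ.Prime ∧ ¬ ℓ ∣ (cubeSumCurve (3 * (p : ℚ) ^ 2)).conductorNorm ℤ ∧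
      ¬ ℓ ∣ (cubeSumCurve (p : ℚ)).conductorNorm ℤ ∧ ¬ ((ℓ : ℤ) ∣ NumberField.discr K) ∧ ℓ ≠ 2 ∧
      (Ideal.span {(ℓ : 𝓞 K)}).IsPrime ∧
      FrobEqFrobInfty (cubeSumCurve (3 * (p : ℚ) ^ 2)) K 2 ℓ ∧ FrobEqFrobInfty (cubeSumCurve (p : ℚ)) K 2 ℓ
  have hle : ∀ ℓ, Kol ℓ → ringClassField K ι (9 * p) ≤ ringClassField K ι (9 * p * ℓ) :=
    fun ℓ h ↦ ringClassField_nine_mul_le hK ι hp0 h.1.ne_zero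
  obtain ⟨σf, yf, φf, σL, y2, φ2, hprime, hσL, hpair⟩ := exists_halfChoices hω h2 ι Dt hp hp3 Kol (fun ℓ h ↦ h) emb hembK s hTFn
  have hσf := fun ℓ (h : Kol ℓ) ↦ (hprime ℓ h).1
  have hyf := fun ℓ (h : Kol ℓ) ↦ (hprime ℓ h).2.1
  have hb1 := fun ℓ (h : Kol ℓ) ↦ half_block1_of_level hω h2 ι hES2 Dt hp hp3 h κ hκG hκ hvBc hvB hvAc hvA0 hvB3 hvA3
    hψB hψA hρ hρρ hlawB hlawA hρcomm (hle ℓ h) (emb (9 * p)) (hembK _) (emb (9 * p * ℓ)) (hembK _)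
    (fun x ↦ hcoh _ _ (hle ℓ h) x) (ιe (9 * p)) (hιe _) (ιe (9 * p * ℓ)) (hιe _) N₀ hN₀ (N (9 * p * ℓ)) (hN _)
    hc₃ hcp H hH T hT t ht' ht sH hsH2 H' hH' (hσf ℓ h) (hyf ℓ h) hy₁ hsy' (φf ℓ) ((hprime ℓ h).2.2.1 (hle ℓ h)) (hprime ℓ h).2.2.2.1 T₃ hT₃ Y₁ hY₁ Y' h2Y' hdivA hdivB
  let cA : ℕ → galH1Torsion ((cubeSumCurve (3 * (p : ℚ) ^ 2)).baseChange K) (2 : ℕ) := fun ℓ ↦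
    if h : Kol ℓ then
      kolyvaginClass ((cubeSumCurve (3 * (p : ℚ) ^ 2)).baseChange K) ((2 : ℕ) : ℤ) hdivA (hb1 ℓ h).fst
        (ψA (∑ i : ((ringClassField K ι (9 * p) ≃ₐ[K] ringClassField K ι (9 * p)) ⧸ H) × H', ρ (t (i.1, (i.2 : H))) (ρ (t (i.1, (i.2 : H))) (t (i.1, (i.2 : H)) • κ.symm (ιe (9 * p * ℓ) (KolyvaginOperator.derivOp
          (pointGalHom (⟨0, 0, 1, 0, -1⟩ : WeierstrassCurve ℚ) (ringClassField K ι (9 * p * ℓ))) (σf ℓ) ℓ (yf ℓ))))))) (hb1 ℓ h).snd.snd.fst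
    else 0
  have hcA : ∀ ℓ (h : Kol ℓ), cA ℓ =
      kolyvaginClass ((cubeSumCurve (3 * (p : ℚ) ^ 2)).baseChange K) ((2 : ℕ) : ℤ) hdivA (hb1 ℓ h).fst
        (ψA (∑ i : ((ringClassField K ι (9 * p) ≃ₐ[K] ringClassField K ι (9 * p)) ⧸ H) × H', ρ (t (i.1, (i.2 : H))) (ρ (t (i.1, (i.2 : H))) (t (i.1, (i.2 : H)) • κ.symm (ιe (9 * p * ℓ) (KolyvaginOperator.derivOp
          (pointGalHom (⟨0, 0, 1, 0, -1⟩ : WeierstrassCurve ℚ) (ringClassField K ι (9 * p * ℓ))) (σf ℓ) ℓ (yf ℓ))))))) (hb1 ℓ h).snd.snd.fst := by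
    intro ℓ h; simp only [cA, dif_pos h]
  have hlepair : ∀ n b : ℕ, b ∣ n → n ≠ 0 → ringClassField K ι (9 * p * b) ≤ ringClassField K ι (9 * p * n) :=
    fun n b hb hn ↦ ringClassField_mono hK ι (mul_dvd_mul_left (9 * p) hb) (mul_ne_zero hm0 hn)
  have hy2 := fun n (h : ∃ a b, Kol a ∧ Kol b ∧ a ≠ b ∧ a * b = n) ↦ (hpair n h).1
  have hb2 : ∀ (n a b : ℕ) (ha : Kol a) (hb : Kol b) (hne : a ≠ b) (hab : a * b = n),
      ∃ (hA₁ : IsAdmissible (absoluteGaloisGroup K)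
          ((FixedPoints.addSubgroup (N (9 * p * n)) (geomPoints ((cubeSumCurve 9).baseChange K))).map
            ψB.toAddMonoidHom) ((2 : ℕ) : ℤ))
        (_ : (∑ i : ((ringClassField K ι (9 * p) ≃ₐ[K] ringClassField K ι (9 * p)) ⧸ H) × H', ρ (t (i.1, (i.2 : H))) (t (i.1, (i.2 : H)) • κ.symm (ιe (9 * p * n) (KolyvaginOperator.derivOp
            (pointGalHom (⟨0, 0, 1, 0, -1⟩ : WeierstrassCurve ℚ) (ringClassField K ι (9 * p * n))) (σL n b a) a
            (KolyvaginOperator.derivOp (pointGalHom (⟨0, 0, 1, 0, -1⟩ : WeierstrassCurve ℚ) (ringClassField K ι (9 * p * n))) (σL n a b) b (y2 n)))))) ∈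
          FixedPoints.addSubgroup (N (9 * p * n)) (geomPoints ((cubeSumCurve 9).baseChange K)))
        (hP₁ : ψB (∑ i : ((ringClassField K ι (9 * p) ≃ₐ[K] ringClassField K ι (9 * p)) ⧸ H) × H', ρ (t (i.1, (i.2 : H))) (t (i.1, (i.2 : H)) • κ.symm (ιe (9 * p * n) (KolyvaginOperator.derivOp
            (pointGalHom (⟨0, 0, 1, 0, -1⟩ : WeierstrassCurve ℚ) (ringClassField K ι (9 * p * n))) (σL n b a) a
            (KolyvaginOperator.derivOp (pointGalHom (⟨0, 0, 1, 0, -1⟩ : WeierstrassCurve ℚ) (ringClassField K ι (9 * p * n))) (σL n a b) b (y2 n)))))) ∈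
          invPoints (absoluteGaloisGroup K)
            ((FixedPoints.addSubgroup (N (9 * p * n)) (geomPoints ((cubeSumCurve 9).baseChange K))).map
              ψB.toAddMonoidHom) ((2 : ℕ) : ℤ)),
        (∀ h ∈ N (9 * p * n), (show AlgebraicClosure K ≃ₐ[K] AlgebraicClosure K from h) vB = vB) ∧
        ∀ (v : HeightOneSpectrum (𝓞 K)), (a : 𝓞 K) ∈ v.asIdeal →
          (kolyvaginClass ((cubeSumCurve (p : ℚ)).baseChange K) ((2 : ℕ) : ℤ) hdivB hA₁
              (ψB (∑ i : ((ringClassField K ι (9 * p) ≃ₐ[K] ringClassField K ι (9 * p)) ⧸ H) × H', ρ (t (i.1, (i.2 : H))) (t (i.1, (i.2 : H)) • κ.symm (ιe (9 * p * n) (KolyvaginOperator.derivOp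
                (pointGalHom (⟨0, 0, 1, 0, -1⟩ : WeierstrassCurve ℚ) (ringClassField K ι (9 * p * n))) (σL n b a) a
                (KolyvaginOperator.derivOp (pointGalHom (⟨0, 0, 1, 0, -1⟩ : WeierstrassCurve ℚ) (ringClassField K ι (9 * p * n))) (σL n a b) b
                  (y2 n))))))) hP₁ ∈
              selmerLocalKer ((cubeSumCurve (p : ℚ)).baseChange K) (v.adicCompletion K) ((2 : ℕ) : ℤ) ↔
            cA b ∈ ((cubeSumCurve (3 * (p : ℚ) ^ 2)).baseChange K).torsionLocalKer (v.adicCompletion K) ((2 : ℕ) : ℤ)) := by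
    intro n a b ha hb hne hab
    have hn0 : n ≠ 0 := hab ▸ mul_ne_zero ha.1.ne_zero hb.1.ne_zero
    have hlean : ringClassField K ι (9 * p * a) ≤ ringClassField K ι (9 * p * n) :=
      hlepair n a (Dvd.intro b hab) hn0
    have hlebn : ringClassField K ι (9 * p * b) ≤ ringClassField K ι (9 * p * n) :=
      hlepair n b (Dvd.intro_left a hab) hn0
    have hle0n : ringClassField K ι (9 * p) ≤ ringClassField K ι (9 * p * n) := ringClassField_nine_mul_le hK ι hp0 hn0
    set ya : ((⟨0, 0, 1, 0, -1⟩ : WeierstrassCurve ℚ).baseChange (ringClassField K ι (9 * p * n))).toAffine.Point :=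
      Affine.Point.map (W' := (⟨0, 0, 1, 0, -1⟩ : WeierstrassCurve ℚ)) ((RingClassField.inclusion ι hlean).restrictScalars ℚ) (yf a) with hyadef
    have hya : Affine.Point.map (W' := (⟨0, 0, 1, 0, -1⟩ : WeierstrassCurve ℚ)) (ringClassField K ι (9 * p * n)).subtype.toRatAlgHom ya =
        Dt.φ (heegnerTau ((a : ℤ) ^ 2 * (81 * ((p : ℤ) ^ 2 + 4 * p + 16)),
          (a : ℤ) * (-(9 * (4 * (p : ℤ) ^ 2 + 17 * p + 72))), 4 * (p : ℤ) ^ 2 + 18 * p + 81)) := by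
      rw [← hyf a ha, hyadef]
      exact map_toRatAlgHom_map_inclusion (W := (⟨0, 0, 1, 0, -1⟩ : WeierstrassCurve ℚ)) ι hlean (ringClassField K ι (9 * p * n)).subtype
        (ringClassField K ι (9 * p * a)).subtype (fun x' ↦ RingClassField.coe_inclusion ι hlean x') (yf a)
    have hy2' : Affine.Point.map (W' := (⟨0, 0, 1, 0, -1⟩ : WeierstrassCurve ℚ)) (ringClassField K ι (9 * p * n)).subtype.toRatAlgHom (y2 n) =
        Dt.φ (heegnerTau (((a * b : ℕ) : ℤ) ^ 2 * (81 * ((p : ℤ) ^ 2 + 4 * p + 16)),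
          ((a * b : ℕ) : ℤ) * (-(9 * (4 * (p : ℤ) ^ 2 + 17 * p + 72))), 4 * (p : ℤ) ^ 2 + 18 * p + 81)) := by
      rw [hab]; exact hy2 n ⟨a, b, ha, hb, hne, hab⟩
    obtain ⟨hσ1, -⟩ := hσL n b a ⟨hb, ha, hne.symm, by rw [mul_comm]; exact hab⟩
    obtain ⟨hσ2, hσ2res'⟩ := hσL n a b ⟨ha, hb, hne, hab⟩
    have hσ2res := hσ2res' hlebn
    obtain ⟨hA₁, hQN, hP₁, hNvB, hiff⟩ := half_block2_of_level hω h2 ι hES2 Dt hp hp3 ha hb hne (m := 9 * p * n)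
      (by rw [hab]) κ hκG hκ hvBc hvB hvAc hvA0 hvB3 hvA3 hψB hψA hρ hρρ hlawB hlawA hρcomm (emb (9 * p)) (hembK _)
      N₀ hN₀ hc₃ hcp H hH T hT t ht' sH hsH2 H' hH' hy₁ (hle b hb) (emb (9 * p * b)) (hembK _) (fun x ↦ hcoh _ _ (hle b hb) x) (ιe (9 * p * b))
      (hιe _) (N (9 * p * b)) (hN _) (hσf b hb) (hyf b hb) (hdivA := hdivA) (hdivB := hdivB) (hb1 b hb).fst
      (hb1 b hb).snd.fst (hb1 b hb).snd.snd.fst (hb1 b hb).snd.snd.snd.1 hlebn hle0n (emb (9 * p * n)) (hembK _)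
      (fun x ↦ hcoh _ _ hlebn x) (fun x ↦ hcoh _ _ hle0n x) (ιe (9 * p * n)) (hιe _) (N (9 * p * n)) (hN _)
      hσ1 hσ2 hσ2res hy2' hya (φ2 n) ((hpair n ⟨a, b, ha, hb, hne, hab⟩).2.1 hle0n) (hpair n ⟨a, b, ha, hb, hne, hab⟩).2.2.1
    exact ⟨hA₁, hQN, hP₁, hNvB, fun v hv ↦ by rw [hcA b hb]; exact hiff v hv⟩
  let cB : ℕ → galH1Torsion ((cubeSumCurve (p : ℚ)).baseChange K) (2 : ℕ) := fun n ↦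
    if h : Kol n.minFac ∧ Kol (n / n.minFac) ∧ n.minFac ≠ n / n.minFac ∧ n.minFac * (n / n.minFac) = n then
      kolyvaginClass ((cubeSumCurve (p : ℚ)).baseChange K) ((2 : ℕ) : ℤ) hdivB
        (hb2 n _ _ h.1 h.2.1 h.2.2.1 h.2.2.2).fst
        (ψB (∑ i : ((ringClassField K ι (9 * p) ≃ₐ[K] ringClassField K ι (9 * p)) ⧸ H) × H', ρ (t (i.1, (i.2 : H))) (t (i.1, (i.2 : H)) • κ.symm (ιe (9 * p * n) (KolyvaginOperator.derivOp
          (pointGalHom (⟨0, 0, 1, 0, -1⟩ : WeierstrassCurve ℚ) (ringClassField K ι (9 * p * n))) (σL n (n / n.minFac) n.minFac) n.minFac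
          (KolyvaginOperator.derivOp (pointGalHom (⟨0, 0, 1, 0, -1⟩ : WeierstrassCurve ℚ) (ringClassField K ι (9 * p * n))) (σL n n.minFac (n / n.minFac))
            (n / n.minFac) (y2 n)))))))
        (hb2 n _ _ h.1 h.2.1 h.2.2.1 h.2.2.2).snd.snd.fst
    else 0
  have hcongr : ∀ {A : AddSubgroup (geomPoints ((cubeSumCurve (p : ℚ)).baseChange K))}
      (hA hA' : IsAdmissible (absoluteGaloisGroup K) A ((2 : ℕ) : ℤ))
      {P P' : geomPoints ((cubeSumCurve (p : ℚ)).baseChange K)}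
      (hP : P ∈ invPoints (absoluteGaloisGroup K) A ((2 : ℕ) : ℤ))
      (hP' : P' ∈ invPoints (absoluteGaloisGroup K) A ((2 : ℕ) : ℤ)), P = P' →
      kolyvaginClass ((cubeSumCurve (p : ℚ)).baseChange K) ((2 : ℕ) : ℤ) hdivB hA P hP =
        kolyvaginClass ((cubeSumCurve (p : ℚ)).baseChange K) ((2 : ℕ) : ℤ) hdivB hA' P' hP' := by
    intro A hA hA' P P' hP hP' e; subst e; rfl
  refine L1_of_cmFrameClasses_seven hω h2 hp hp7 Y' ⟨cA, cB, fun ℓ hℓ ↦ ⟨?_, fun v hv ↦ by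
      rw [hcA ℓ hℓ]; exact (hb1 ℓ hℓ).snd.snd.snd.2 v hv⟩, fun ℓ ℓ' hℓ hℓ' hne ↦ ?_⟩
  · obtain ⟨hA₁, hQN, hP₁, hNvA, -⟩ := hb1 ℓ hℓ
    exact ⟨ι, emb (9 * p * ℓ), hembK _, N (9 * p * ℓ), hN _, vA, ψA, hψA, hNvA, _, hdivA, hA₁, _, hQN, hP₁, hcA ℓ hℓ⟩
  · haveI : IsMulCommutative (ringClassGal ι (9 * p * (ℓ * ℓ'))) :=
      KolyvaginH44.isMulCommutative_ringClassGal' hK ι _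
    obtain ⟨hA₁f, hQNf, hP₁f, hNvBf, hifff⟩ := hb2 (ℓ * ℓ') ℓ ℓ' hℓ hℓ' hne rfl
    have hPK : Kol (ℓ * ℓ').minFac ∧ Kol (ℓ * ℓ' / (ℓ * ℓ').minFac) ∧ (ℓ * ℓ').minFac ≠ ℓ * ℓ' / (ℓ * ℓ').minFac ∧
        (ℓ * ℓ').minFac * (ℓ * ℓ' / (ℓ * ℓ').minFac) = ℓ * ℓ' := by
      rcases lt_or_gt_of_ne hne with hlt | hgt
      · obtain ⟨e1, e2⟩ := minFac_mul_of_lt hℓ.1 hℓ'.1 hlt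
        rw [e2, e1]; exact ⟨hℓ, hℓ', hne, rfl⟩
      · obtain ⟨e1, e2⟩ := minFac_mul_of_lt hℓ'.1 hℓ.1 hgt
        rw [Nat.mul_comm ℓ' ℓ] at e1 e2
        rw [e2, e1]; exact ⟨hℓ', hℓ, hne.symm, Nat.mul_comm ℓ' ℓ⟩
    have hpt : ψB (∑ i : ((ringClassField K ι (9 * p) ≃ₐ[K] ringClassField K ι (9 * p)) ⧸ H) × H', ρ (t (i.1, (i.2 : H))) (t (i.1, (i.2 : H)) • κ.symm (ιe (9 * p * (ℓ * ℓ')) (KolyvaginOperator.derivOp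
          (pointGalHom (⟨0, 0, 1, 0, -1⟩ : WeierstrassCurve ℚ) (ringClassField K ι (9 * p * (ℓ * ℓ'))))
          (σL (ℓ * ℓ') (ℓ * ℓ' / (ℓ * ℓ').minFac) (ℓ * ℓ').minFac) (ℓ * ℓ').minFac
          (KolyvaginOperator.derivOp (pointGalHom (⟨0, 0, 1, 0, -1⟩ : WeierstrassCurve ℚ) (ringClassField K ι (9 * p * (ℓ * ℓ'))))
            (σL (ℓ * ℓ') (ℓ * ℓ').minFac (ℓ * ℓ' / (ℓ * ℓ').minFac)) (ℓ * ℓ' / (ℓ * ℓ').minFac) (y2 (ℓ * ℓ'))))))) =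
        ψB (∑ i : ((ringClassField K ι (9 * p) ≃ₐ[K] ringClassField K ι (9 * p)) ⧸ H) × H', ρ (t (i.1, (i.2 : H))) (t (i.1, (i.2 : H)) • κ.symm (ιe (9 * p * (ℓ * ℓ')) (KolyvaginOperator.derivOp
          (pointGalHom (⟨0, 0, 1, 0, -1⟩ : WeierstrassCurve ℚ) (ringClassField K ι (9 * p * (ℓ * ℓ')))) (σL (ℓ * ℓ') ℓ' ℓ) ℓ
          (KolyvaginOperator.derivOp (pointGalHom (⟨0, 0, 1, 0, -1⟩ : WeierstrassCurve ℚ) (ringClassField K ι (9 * p * (ℓ * ℓ')))) (σL (ℓ * ℓ') ℓ ℓ') ℓ'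
            (y2 (ℓ * ℓ'))))))) := by
      rcases lt_or_gt_of_ne hne with hlt | hgt
      · obtain ⟨e1, e2⟩ := minFac_mul_of_lt hℓ.1 hℓ'.1 hlt
        rw [e2, e1]
      · obtain ⟨e1, e2⟩ := minFac_mul_of_lt hℓ'.1 hℓ.1 hgt
        rw [Nat.mul_comm ℓ' ℓ] at e1 e2
        rw [e2, e1]
        have hσG : σL (ℓ * ℓ') ℓ ℓ' ∈ ringClassGal ι (9 * p * (ℓ * ℓ')) :=
          ringClassGalOver_le_ringClassGal ι _ _
            ((hσL _ _ _ ⟨hℓ, hℓ', hne, rfl⟩).1 ▸ Subgroup.mem_zpowers (σL (ℓ * ℓ') ℓ ℓ'))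
        have hσ'G : σL (ℓ * ℓ') ℓ' ℓ ∈ ringClassGal ι (9 * p * (ℓ * ℓ')) :=
          ringClassGalOver_le_ringClassGal ι _ _
            ((hσL _ _ _ ⟨hℓ', hℓ, hne.symm, Nat.mul_comm ℓ' ℓ⟩).1 ▸ Subgroup.mem_zpowers (σL (ℓ * ℓ') ℓ' ℓ))
        have hcomm : Commute (σL (ℓ * ℓ') ℓ ℓ') (σL (ℓ * ℓ') ℓ' ℓ) := by
          have h := (KolyvaginH44.isMulCommutative_ringClassGal' hK ι (9 * p * (ℓ * ℓ'))).is_comm.comm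
            ⟨_, hσG⟩ ⟨_, hσ'G⟩
          exact congrArg Subtype.val h
        rw [derivOp_derivOp_comm (⟨0, 0, 1, 0, -1⟩ : WeierstrassCurve ℚ) hcomm]
    have hcBeq : cB (ℓ * ℓ') = kolyvaginClass ((cubeSumCurve (p : ℚ)).baseChange K) ((2 : ℕ) : ℤ) hdivB hA₁f
        (ψB (∑ i : ((ringClassField K ι (9 * p) ≃ₐ[K] ringClassField K ι (9 * p)) ⧸ H) × H', ρ (t (i.1, (i.2 : H))) (t (i.1, (i.2 : H)) • κ.symm (ιe (9 * p * (ℓ * ℓ')) (KolyvaginOperator.derivOp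
          (pointGalHom (⟨0, 0, 1, 0, -1⟩ : WeierstrassCurve ℚ) (ringClassField K ι (9 * p * (ℓ * ℓ')))) (σL (ℓ * ℓ') ℓ' ℓ) ℓ
          (KolyvaginOperator.derivOp (pointGalHom (⟨0, 0, 1, 0, -1⟩ : WeierstrassCurve ℚ) (ringClassField K ι (9 * p * (ℓ * ℓ')))) (σL (ℓ * ℓ') ℓ ℓ') ℓ'
            (y2 (ℓ * ℓ')))))))) hP₁f := by
      simp only [cB, dif_pos hPK]; exact hcongr _ _ _ _ hpt
    refine ⟨⟨ι, emb (9 * p * (ℓ * ℓ')), hembK _, N (9 * p * (ℓ * ℓ')), hN _, vB, ψB, hψB, hNvBf, _, hdivB, hA₁f, _,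
      hQNf, hP₁f, hcBeq⟩, fun v hv3 ↦ ?_, fun v hv ↦ ?_⟩
    · obtain ⟨Φ, hΦ, hcop, hΦdich⟩ := (hpair (ℓ * ℓ') ⟨ℓ, ℓ', hℓ, hℓ', hne, rfl⟩).2.2.2 v hv3
      rw [hcBeq]
      exact half_pairClass_mem_selmerLocalKer_three hω h2 ι hp0 (mul_ne_zero hm0 (mul_ne_zero hℓ.1.ne_zero hℓ'.1.ne_zero))
        κ hκG hvBc hvB hvB3 hψB hρ (emb (9 * p)) hc₃ hcp hs3 hsp
        (ringClassField_nine_mul_le hK ι hp0 (mul_ne_zero hℓ.1.ne_zero hℓ'.1.ne_zero)) (emb (9 * p * (ℓ * ℓ'))) (hembK _)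
        (fun x ↦ hcoh _ _ _ x) (ιe (9 * p * (ℓ * ℓ'))) (hιe _) (N (9 * p * (ℓ * ℓ'))) (hN _)
        (fun i : ((ringClassField K ι (9 * p) ≃ₐ[K] ringClassField K ι (9 * p)) ⧸ H) × H' ↦ t (i.1, (i.2 : H)))
        (hσL _ _ _ ⟨hℓ', hℓ, hne.symm, Nat.mul_comm ℓ' ℓ⟩).1 (hσL _ _ _ ⟨hℓ, hℓ', hne, rfl⟩).1 ℓ ℓ' hA₁f hP₁f (φ2 (ℓ * ℓ'))
        ((hpair (ℓ * ℓ') ⟨ℓ, ℓ', hℓ, hℓ', hne, rfl⟩).2.1 _) (hpair (ℓ * ℓ') ⟨ℓ, ℓ', hℓ, hℓ', hne, rfl⟩).2.2.1 v Φ hΦ hcop hΦdich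
    · rw [hcBeq]; exact hifff v hv

end Summit.BirchSwinnertonDyer.BirchSwinnertonDyer.Theorems.SylvesterTwoCMHalf

end
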